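import Literature.Probability.Percolation.SmirnovSeparatingData
import HarnessLib

/-!
# Route CardyBondTriangular · crux `BondTriangularCardy` (stmt-CriticalPhenomena-4664), line `birth`:
# the contour relation of limits of WEAK separating data, and `Σ Gⁱ` is constant

Helper file of the analysis stub `stub_weakBoundaryUpgrade`. Two facts:

* `limit_contour_weak` — Bollobás–Riordan's Claim 23, (36) (Ch. 7 p. 199): a uniform limit `G` on
  `closure Ω` of the McShane interpolants of discrete data satisfies
  `∮_{∂T} (G^{i+1} - ω Gⁱ) dz = 0` for every lattice triangle `T ⊆ Ω`. This is the tree's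
  `limit_boundary_open_of_separatingData`-companion `limit_contour_of_separatingData`
  (`SmirnovSeparatingData.lean`) re-proved VERBATIM from the individual clauses `mem_Icc`,
  `equicontinuous`, `interior`, `cauchy` (the tree's lemma takes bundled `IsSeparatingData`, whose
  boundary clause the weak data of the line do not have).
* `exists_sum_limit_eq_const` — the step "by Morera `Σ gⁱ` is analytic … `≡` const" of the proof
  of Claim 24 (p. 201; Smirnov 2001): summing (36) over `i` gives `(1 - ω) ∮_{∂T} Σ Gⁱ dz = 0`,
  so for `ω ≠ 1` the real continuous function `Σ Gⁱ` has vanishing integrals around all lattice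
  triangles in `Ω`, is holomorphic there (lattice Morera, `differentiableOn_of_forall_latticeTriangle`),
  hence constant on the connected open set `Ω` (`exists_eq_const_of_im_eq_zero`) and on its closure.

References: B. Bollobás, O. Riordan, *Percolation*, CUP 2006, Ch. 7, Claim 23 p. 199, Claim 24
p. 201; S. Smirnov, C. R. Acad. Sci. Paris 333 (2001) 239–244.
-/

noncomputable section

namespace Summit.CriticalPhenomena.CardyFormulaZ2.Theorems.BondTriangularCardyLine

open Set Filter Topology Metric MeasureTheory
open Literature.Probability.Percolation Literature.Probability.RandomPlanarGeometry
open Literature.Probability.RandomPlanarGeometry.MarkedDomain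
open Literature.Probability.LatticeModels

variable {R : ConformalRectangle} {ω : ℂ} {S : ℝ → Finset ℂ} {f : ℝ → Fin 3 → ℂ → ℝ} {ε : ℝ → ℝ}

/-- `f ≤ g ≤ f + o(1)` on `S_δ` for the interpolants, from `mem_Icc` and `equicontinuous`
(Bollobás–Riordan 2006, (39) p. 200; this is `dataFamily_approx_weak` of the companion file
`…BondTriangularCardyWeakLimits`, re-proved privately to keep the two helper files independent). [cite: BollobasRiordan2006, Ch. 7 (39) p. 200] -/
private theorem dataFamily_approx_aux
    (hIcc : ∀ (δ : ℝ) (i : Fin 3), ∀ w ∈ S δ, f δ i w ∈ Icc (0 : ℝ) 1)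
    (hequi : ∀ β > (0 : ℝ), ∃ η > (0 : ℝ), ∀ᶠ δ in 𝓝[>] (0 : ℝ), ∀ (i : Fin 3),
      ∀ z ∈ S δ, ∀ w ∈ S δ, dist z w < η → f δ i z - f δ i w ≤ β)
    (hε : Tendsto ε (𝓝[>] 0) (𝓝 0)) {β : ℝ} (hβ : 0 < β) :
    ∀ᶠ δ in 𝓝[>] (0 : ℝ), ∀ (i : Fin 3), ∀ w ∈ S δ,
      f δ i w ≤ dataFamily S f ε δ i w ∧ dataFamily S f ε δ i w ≤ f δ i w + β := by
  -- adapted from `Literature.Probability.Percolation.dataFamily_approx`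
  obtain ⟨η, hη, hev⟩ := hequi β hβ
  have hρ : ∀ᶠ δ in 𝓝[>] (0 : ℝ), interpScale ε δ < η :=
    (tendsto_interpScale hε).eventually (gt_mem_nhds hη)
  have hpos : ∀ᶠ δ in 𝓝[>] (0 : ℝ), 0 < δ := eventually_mem_nhdsWithin
  filter_upwards [hev, hρ, hpos] with δ hev hρ hδ i w hw
  refine ⟨mcShane.le_self hw, ?_⟩
  obtain ⟨w', hw', hle, hd⟩ := mcShane.exists_le (interpScale_pos ε hδ)
    (fun v hv => (hIcc δ i v hv).1) (fun v hv => (hIcc δ i v hv).2) w hw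
    (by rw [dist_self]; exact (interpScale_pos ε hδ).le)
  have := hev i w' hw' w hw (by rw [dist_comm]; exact lt_of_le_of_lt hd hρ)
  unfold dataFamily
  linarith

/-- **Claim 23, (36)** (Bollobás–Riordan 2006, p. 199) for weak data: if `g_{δ_n}ⁱ → Gⁱ`
uniformly on `closure Ω` along `δ_n → 0⁺`, each `Gⁱ` continuous on the plane, then
`∮_{∂T} (G^{i+1} - ω Gⁱ) dz = 0` for every lattice-parallel solid triangle `T ⊆ Ω` — from the
clauses `mem_Icc`, `equicontinuous`, `interior` and `cauchy` (Lemma 13) only. Proof verbatim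
that of `limit_contour_of_separatingData`: lattice contours `C_δ → C` inside a compact
neighbourhood `K ⊆ Ω` of `T`; `∮ᴰ_{C_δ} f_δ = ∮_{C_δ} G + o(1)`; `∮_{C_δ} G → ∮_C G`; Lemma 13.
[cite: BollobasRiordan2006, Ch. 7 Claim 23 (36) p. 199] -/
theorem limit_contour_weak
    (hIcc : ∀ (δ : ℝ) (i : Fin 3), ∀ w ∈ S δ, f δ i w ∈ Icc (0 : ℝ) 1)
    (hequi : ∀ β > (0 : ℝ), ∃ η > (0 : ℝ), ∀ᶠ δ in 𝓝[>] (0 : ℝ), ∀ (i : Fin 3),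
      ∀ z ∈ S δ, ∀ w ∈ S δ, dist z w < η → f δ i z - f δ i w ≤ β)
    (hint : ∀ K : Set ℂ, IsCompact K → K ⊆ R.carrier →
      ∀ᶠ δ : ℝ in 𝓝[>] 0, ∀ x : HexVertex,
        (δ : ℂ) * hexCenter x ∈ K → (δ : ℂ) * hexCenter x ∈ S δ)
    (hcau : ∃ e : ℝ → ℝ, Tendsto e (𝓝[>] 0) (𝓝 0) ∧ ∀ K : Set ℂ, IsCompact K → K ⊆ R.carrier →
      ∀ᶠ δ in 𝓝[>] (0 : ℝ), ∀ (i : Fin 3) (x : Site 2) (n : ℕ) (s : ℝ), (s = δ ∨ s = -δ) →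
        convexHull ℝ {triMeshPoint δ x, triMeshPoint δ x + n * s,
            triMeshPoint δ x + n * s * triZeta} ⊆ K →
          ‖discreteTriangleIntegral (f δ (i + 1)) (triMeshPoint δ x) s n -
              ω * discreteTriangleIntegral (f δ i) (triMeshPoint δ x) s n‖ ≤ n * δ * e δ)
    (hε : Tendsto ε (𝓝[>] 0) (𝓝 0)) {u : ℕ → ℝ} (hupos : ∀ n, 0 < u n)
    (hu0 : Tendsto u atTop (𝓝 0)) {G : Fin 3 → ℂ → ℝ} (hGc : ∀ i, Continuous (G i))
    (hunif : ∀ i, TendstoUniformlyOn (fun n => dataFamily S f ε (u n) i) (G i) atTop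
      (closure R.carrier))
    (i : Fin 3) (p : ℂ) (r : ℝ)
    (hT : convexHull ℝ {p, p + r, p + r * triZeta} ⊆ R.carrier) :
    triangleIntegral (fun w => (G (i + 1) w : ℂ) - ω * G i w) p (p + r) (p + r * triZeta) = 0 := by
  -- adapted (verbatim) from `Literature.Probability.Percolation.limit_contour_of_separatingData`
  classical
  rcases eq_or_ne r 0 with rfl | hr
  · simp
  have hu : Tendsto u atTop (𝓝[>] 0) :=
    tendsto_nhdsWithin_iff.2 ⟨hu0, Eventually.of_forall fun n => hupos n⟩
  -- Step 1: a compact convex neighbourhood `K ⊆ Ω` of the solid triangle `T`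
  set T : Set ℂ := convexHull ℝ {p, p + r, p + r * triZeta} with hT_def
  have hTc : IsCompact T := Set.Finite.isCompact_convexHull (𝕜 := ℝ) (Set.toFinite _)
  obtain ⟨κ, hκ, hKΩ⟩ := hTc.exists_cthickening_subset_open R.isOpen hT
  set K : Set ℂ := cthickening κ T with hK_def
  have hKc : IsCompact K := hTc.cthickening
  have hKconv : Convex ℝ K := (convex_convexHull ℝ _).cthickening κ
  have hKcl : K ⊆ closure R.carrier := hKΩ.trans subset_closure
  have hpT : p ∈ T := subset_convexHull ℝ _ (by simp)
  have hqT : p + r ∈ T := subset_convexHull ℝ _ (by simp)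
  have hrT : p + r * triZeta ∈ T := subset_convexHull ℝ _ (by simp)
  -- Step 2: lattice approximants `C_n` of the contour
  choose xs hxs using fun n => exists_site_dist_le p (hupos n)
  set σ : ℝ := if 0 < r then 1 else -1 with hσ_def
  have hσ : σ = 1 ∨ σ = -1 := by
    by_cases h : 0 < r
    · exact Or.inl (by simp [hσ_def, h])
    · exact Or.inr (by simp [hσ_def, h])
  have hσabs : |σ| = 1 := by rcases hσ with h | h <;> simp [h]
  have hσr : σ * |r| = r := by
    by_cases h : 0 < r
    · simp [hσ_def, h, abs_of_pos h]
    · have h' : r < 0 := lt_of_le_of_ne (not_lt.1 h) hr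
      simp [hσ_def, h, abs_of_neg h']
  set N : ℕ → ℕ := fun n => ⌊|r| / u n⌋₊ with hN_def
  set sN : ℕ → ℝ := fun n => σ * u n with hsN_def
  set P : ℕ → ℂ := fun n => triMeshPoint (u n) (xs n) with hP_def
  have hsNabs : ∀ n, |sN n| = u n := fun n => by
    rw [hsN_def]; simp only; rw [abs_mul, hσabs, one_mul, abs_of_pos (hupos n)]
  have hsN : ∀ n, sN n = u n ∨ sN n = -u n := fun n => by
    rcases hσ with h | h
    · exact Or.inl (by simp [hsN_def, h])
    · exact Or.inr (by simp [hsN_def, h])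
  -- `N_n u_n → |r|` with `|N_n u_n - |r|| ≤ u_n`, and `N_n u_n ≤ |r|`
  have hNle : ∀ n, (N n : ℝ) * u n ≤ |r| := fun n => by
    have := Nat.floor_le (div_nonneg (abs_nonneg r) (hupos n).le)
    rw [hN_def]
    exact (le_div_iff₀ (hupos n)).1 this
  have hNge : ∀ n, |r| - u n ≤ (N n : ℝ) * u n := fun n => by
    have := Nat.lt_floor_add_one (|r| / u n)
    rw [hN_def]
    have h2 : |r| < ((⌊|r| / u n⌋₊ : ℝ) + 1) * u n := (div_lt_iff₀ (hupos n)).1 this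
    linarith
  have hNs : Tendsto (fun n => ((N n : ℝ) * sN n : ℝ)) atTop (𝓝 r) := by
    have h1 : Tendsto (fun n => (N n : ℝ) * u n) atTop (𝓝 |r|) := by
      refine tendsto_of_tendsto_of_tendsto_of_le_of_le (g := fun n => |r| - u n) (h := fun _ => |r|)
        ?_ tendsto_const_nhds hNge hNle
      simpa using tendsto_const_nhds.sub hu0
    have h2 : (fun n => ((N n : ℝ) * sN n : ℝ)) = fun n => σ * ((N n : ℝ) * u n) := by
      funext n; simp only [hsN_def]; ring
    rw [h2, ← hσr]
    exact h1.const_mul σ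
  -- convergence of the corners
  have hP : Tendsto P atTop (𝓝 p) := by
    rw [tendsto_iff_dist_tendsto_zero]
    refine squeeze_zero (fun n => dist_nonneg) (fun n => hxs n) ?_
    simpa using hu0.const_mul 2
  have hNsC : Tendsto (fun n => (((N n : ℝ) * sN n : ℝ) : ℂ)) atTop (𝓝 (r : ℂ)) :=
    (Complex.continuous_ofReal.tendsto r).comp hNs
  have hc1 : ∀ n, latticeCorner (P n) (sN n) (N n) 1 = P n + (((N n : ℝ) * sN n : ℝ) : ℂ) :=
    fun n => by simp only [latticeCorner_one]; push_cast; ring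
  have hc2 : ∀ n, latticeCorner (P n) (sN n) (N n) 2 =
      P n + (((N n : ℝ) * sN n : ℝ) : ℂ) * triZeta := fun n => by
    simp only [latticeCorner_two]; push_cast; ring
  have hQ : Tendsto (fun n => latticeCorner (P n) (sN n) (N n) 1) atTop (𝓝 (p + r)) := by
    simp only [hc1]; exact hP.add hNsC
  have hRr : Tendsto (fun n => latticeCorner (P n) (sN n) (N n) 2) atTop
      (𝓝 (p + r * triZeta)) := by
    simp only [hc2]; exact hP.add (hNsC.mul tendsto_const_nhds)
  -- Step 3: eventually the lattice triangle `T_n` lies in `K`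
  have hdistQ : ∀ n, dist (latticeCorner (P n) (sN n) (N n) 1) (p + r) ≤ 3 * u n := fun n => by
    rw [hc1]
    calc dist (P n + (((N n : ℝ) * sN n : ℝ) : ℂ)) (p + r)
        ≤ dist (P n) p + dist ((((N n : ℝ) * sN n : ℝ) : ℂ)) (r : ℂ) := dist_add_add_le _ _ _ _
      _ ≤ 2 * u n + u n := by
          refine add_le_add (hxs n) ?_
          rw [dist_eq_norm, ← Complex.ofReal_sub, Complex.norm_real, Real.norm_eq_abs]
          have h1 := hNle n; have h2 := hNge n
          have h3 : (N n : ℝ) * sN n - r = σ * ((N n : ℝ) * u n - |r|) := by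
            simp only [hsN_def]; linear_combination hσr
          rw [h3, abs_mul, hσabs, one_mul, abs_le]
          constructor <;> linarith
      _ = 3 * u n := by ring
  have hdistR : ∀ n, dist (latticeCorner (P n) (sN n) (N n) 2) (p + r * triZeta) ≤ 3 * u n :=
      fun n => by
    rw [hc2]
    calc dist (P n + (((N n : ℝ) * sN n : ℝ) : ℂ) * triZeta) (p + r * triZeta)
        ≤ dist (P n) p + dist ((((N n : ℝ) * sN n : ℝ) : ℂ) * triZeta) ((r : ℂ) * triZeta) :=
          dist_add_add_le _ _ _ _
      _ ≤ 2 * u n + u n := by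
          refine add_le_add (hxs n) ?_
          rw [dist_eq_norm, ← sub_mul, norm_mul, norm_triZeta, mul_one, ← Complex.ofReal_sub,
            Complex.norm_real, Real.norm_eq_abs]
          have h1 := hNle n; have h2 := hNge n
          have h3 : (N n : ℝ) * sN n - r = σ * ((N n : ℝ) * u n - |r|) := by
            simp only [hsN_def]; linear_combination hσr
          rw [h3, abs_mul, hσabs, one_mul, abs_le]
          constructor <;> linarith
      _ = 3 * u n := by ring
  have hsmall : ∀ᶠ n in atTop, 3 * u n ≤ κ := by
    have : Tendsto (fun n => 3 * u n) atTop (𝓝 (3 * 0)) := hu0.const_mul 3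
    rw [mul_zero] at this
    exact this.eventually (ge_mem_nhds hκ)
  have hTn : ∀ᶠ n in atTop, convexHull ℝ {P n, P n + (N n) * (sN n),
      P n + (N n) * (sN n) * triZeta} ⊆ K := by
    filter_upwards [hsmall] with n hn
    refine convexHull_min ?_ hKconv
    have h0 : P n ∈ K := mem_cthickening_of_dist_le _ _ _ _ hpT ((hxs n).trans (by linarith))
    have h1 : P n + (N n) * (sN n) ∈ K :=
      mem_cthickening_of_dist_le (latticeCorner (P n) (sN n) (N n) 1) _ _ _ hqT
        ((hdistQ n).trans hn)
    have h2 : P n + (N n) * (sN n) * triZeta ∈ K :=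
      mem_cthickening_of_dist_le (latticeCorner (P n) (sN n) (N n) 2) _ _ _ hrT
        ((hdistR n).trans hn)
    simp [Set.insert_subset_iff, h0, h1, h2]
  -- Step 4: the three estimates along the sequence
  obtain ⟨e, he, hcau⟩ := hcau
  have hcauK := hu.eventually (hcau K hKc hKΩ)
  have hintK := hu.eventually (hint K hKc hKΩ)
  -- (a) Lemma 13: `∮ᴰ f^{i+1} - ω ∮ᴰ fⁱ → 0`
  set A : ℕ → Fin 3 → ℂ := fun n j => discreteTriangleIntegral (f (u n) j) (P n) (sN n) (N n)
    with hA_def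
  have hAlim : Tendsto (fun n => A n (i + 1) - ω * A n i) atTop (𝓝 0) := by
    rw [tendsto_zero_iff_norm_tendsto_zero]
    have hbound : ∀ᶠ n in atTop, ‖A n (i + 1) - ω * A n i‖ ≤ |r| * |e (u n)| := by
      filter_upwards [hcauK, hTn] with n hn hTn
      have h := hn i (xs n) (N n) (sN n) (hsN n) hTn
      refine h.trans ?_
      calc (N n : ℝ) * u n * e (u n) ≤ (N n : ℝ) * u n * |e (u n)| :=
            mul_le_mul_of_nonneg_left (le_abs_self _) (mul_nonneg (Nat.cast_nonneg _) (hupos n).le)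
        _ ≤ |r| * |e (u n)| := mul_le_mul_of_nonneg_right (hNle n) (abs_nonneg _)
    have hlim : Tendsto (fun n => |r| * |e (u n)|) atTop (𝓝 0) := by
      have := (he.comp hu).abs
      simpa using this.const_mul |r|
    exact squeeze_zero' (Eventually.of_forall fun n => norm_nonneg _) hbound hlim
  -- (b) `∮ᴰ f_nʲ - ∮_{C_n} Gʲ → 0`
  set Bx : ℕ → Fin 3 → ℂ := fun n j => triangleIntegral (fun w => (G j w : ℂ))
    (latticeCorner (P n) (sN n) (N n) 0) (latticeCorner (P n) (sN n) (N n) 1)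
    (latticeCorner (P n) (sN n) (N n) 2) with hBx_def
  have hAB : ∀ j, Tendsto (fun n => A n j - Bx n j) atTop (𝓝 0) := by
    intro j
    rw [Metric.tendsto_atTop]
    intro η hη
    -- choose `β` with `9 |r| β < η`
    obtain ⟨β, hβ, hβη⟩ : ∃ β > (0 : ℝ), 9 * |r| * β < η :=
      ⟨η / (9 * |r| + 1), div_pos hη (by positivity), by
        rw [mul_div_assoc']
        rw [div_lt_iff₀ (by positivity)]
        nlinarith [abs_nonneg r]⟩
    -- uniform continuity of `G j` on `K`
    obtain ⟨θ, hθ, hθuc⟩ := Metric.uniformContinuousOn_iff.1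
      (hKc.uniformContinuousOn_of_continuous (hGc j).continuousOn) β hβ
    have happ := hu.eventually (dataFamily_approx_aux hIcc hequi hε hβ)
    have hunifβ := (Metric.tendstoUniformlyOn_iff.1 (hunif j)) β hβ
    have hθn : ∀ᶠ n in atTop, u n < θ := hu0.eventually (gt_mem_nhds hθ)
    obtain ⟨M, hM⟩ := eventually_atTop.1 ((((happ.and hunifβ).and (hintK.and hTn)).and hθn))
    refine ⟨M, fun n hn => ?_⟩
    obtain ⟨⟨⟨happ, hunifβ⟩, hintK, hTn⟩, hθn⟩ := hM n hn
    rw [dist_zero_right]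
    have hest := norm_discreteTriangleIntegral_sub_le (hGc j) (f (u n) j) (P n) (sN n) (N n)
      (B := 3 * β) ?_
    · calc ‖A n j - Bx n j‖ ≤ 3 * (N n) * |sN n| * (3 * β) := hest
        _ = 9 * ((N n : ℝ) * u n) * β := by rw [hsNabs]; ring
        _ ≤ 9 * |r| * β := by nlinarith [hNle n, hβ]
        _ < η := hβη
    · intro k j' hj' τ hτ
      set z : ℂ := latticeCorner (P n) (sN n) (N n) k + ((sN n * τ : ℝ) : ℂ) * latticeDir k
      set c : ℂ := latticeEdgeCentre (P n) (sN n) (N n) k j'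
      have hcT : c ∈ K := hTn (latticeEdgeCentre_mem_convexHull (P n) (sN n) hj' k)
      have hzT : z ∈ K := hTn (latticeEdge_mem_convexHull (P n) (sN n) k hj' hτ)
      obtain ⟨x, hx⟩ := exists_hexCenter_eq_latticeEdgeCentre (u n) (xs n) (N n) k j' (hsN n)
      have hcS : c ∈ S (u n) := by
        have := hintK x (by rw [← hx]; exact hcT)
        rwa [← hx] at this
      have h1 : dist (G j z) (G j c) < β :=
        hθuc z hzT c hcT ((dist_latticeEdgeCentre_le (P n) (sN n) (N n) k hτ).trans_lt
          (by rw [hsNabs]; exact hθn))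
      have h2 : dist (G j c) (dataFamily S f ε (u n) j c) < β := hunifβ c (hKcl hcT)
      have h3 := happ j c hcS
      rw [Real.dist_eq] at h1 h2
      have := abs_sub_lt_iff.1 h1
      have := abs_sub_lt_iff.1 h2
      rw [abs_le]
      constructor <;> linarith [h3.1, h3.2]
  -- (c) `∮_{C_n} Gʲ → ∮_C Gʲ`
  have hBlim : ∀ j, Tendsto (fun n => Bx n j) atTop
      (𝓝 (triangleIntegral (fun w => (G j w : ℂ)) p (p + r) (p + r * triZeta))) := by
    intro j
    have hGj : Continuous fun w => (G j w : ℂ) := Complex.continuous_ofReal.comp (hGc j)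
    have := tendsto_triangleIntegral hGj hP hQ hRr
    exact this
  -- Step 5: conclusion
  have hGi : Continuous fun w => (G i w : ℂ) := Complex.continuous_ofReal.comp (hGc i)
  have hGi1 : Continuous fun w => (G (i + 1) w : ℂ) := Complex.continuous_ofReal.comp (hGc (i + 1))
  rw [triangleIntegral_sub_mul hGi1 hGi]
  have hlim1 : Tendsto (fun n => Bx n (i + 1) - ω * Bx n i) atTop
      (𝓝 (triangleIntegral (fun w => (G (i + 1) w : ℂ)) p (p + r) (p + r * triZeta) -
        ω * triangleIntegral (fun w => (G i w : ℂ)) p (p + r) (p + r * triZeta))) :=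
    (hBlim (i + 1)).sub ((hBlim i).const_mul ω)
  have hlim2 : Tendsto (fun n => Bx n (i + 1) - ω * Bx n i) atTop (𝓝 0) := by
    have h := (hAlim.sub (hAB (i + 1))).add ((hAB i).const_mul ω)
    simp only [sub_zero, mul_zero, add_zero] at h
    refine h.congr fun n => ?_
    ring
  exact tendsto_nhds_unique hlim1 hlim2

/-- **`Σ Gⁱ` is constant** (the step "by Morera `Σ gⁱ` is analytic … `≡ 1`" in the proof of
Claim 24, Bollobás–Riordan 2006 p. 201; Smirnov 2001): if the continuous functions `G⁰, G¹, G²`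
satisfy the contour relation (36) on all lattice triangles in `Ω` with `ω ≠ 1`, then, summing
over `i`, `(1 - ω) ∮ Σ Gⁱ = 0`, so the real function `Σ Gⁱ` is holomorphic on `Ω` (lattice
Morera), hence constant on `Ω` (open mapping) and on `closure Ω` (continuity). [cite: BollobasRiordan2006, Ch. 7 proof of Claim 24 p. 201] -/
theorem exists_sum_limit_eq_const :
    ∀ (R : Literature.Probability.RandomPlanarGeometry.ConformalRectangle) (ω : ℂ)
      (G : Fin 3 → ℂ → ℝ), ω ≠ 1 → (∀ i, Continuous (G i)) →
      (∀ (i : Fin 3) (p : ℂ) (r : ℝ),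
        convexHull ℝ {p, p + r, p + r * Literature.Probability.LatticeModels.triZeta} ⊆ R.carrier →
          Literature.Probability.Percolation.triangleIntegral
            (fun w => (G (i + 1) w : ℂ) - ω * G i w) p (p + r)
            (p + r * Literature.Probability.LatticeModels.triZeta) = 0) →
      ∃ c : ℝ, ∀ z ∈ closure R.carrier, G 0 z + G 1 z + G 2 z = c := by
  intro R ω G hω hGc h36
  -- the functions `Fⁱ = G^{i+1} - ω Gⁱ` and `Sg = Σ Gⁱ = (1 - ω)⁻¹ Σ Fⁱ`
  obtain ⟨F, hF⟩ : ∃ F : Fin 3 → ℂ → ℂ, F = fun i w => (G (i + 1) w : ℂ) - ω * G i w := ⟨_, rfl⟩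
  obtain ⟨Sg, hSg⟩ : ∃ Sg : ℂ → ℂ, Sg = fun w => (G 0 w : ℂ) + (G 1 w : ℂ) + (G 2 w : ℂ) :=
    ⟨_, rfl⟩
  have hGc' : ∀ i, Continuous fun w => (G i w : ℂ) := fun i =>
    Complex.continuous_ofReal.comp (hGc i)
  have hFc : ∀ i, Continuous (F i) := fun i => by
    rw [hF]; exact (hGc' (i + 1)).sub (continuous_const.mul (hGc' i))
  have hSgc : Continuous Sg := by
    rw [hSg]; exact ((hGc' 0).add (hGc' 1)).add (hGc' 2)
  have h1ω : (1 - ω) ≠ 0 := sub_ne_zero.2 (Ne.symm hω)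
  have hSg_eq : Sg = fun w => (1 - ω)⁻¹ * F 0 w + (1 - ω)⁻¹ * F 1 w + (1 - ω)⁻¹ * F 2 w := by
    rw [hSg, hF]
    funext w
    simp only [zero_add, Fin.isValue, show (1 : Fin 3) + 1 = 2 from rfl,
      show (2 : Fin 3) + 1 = 0 from rfl]
    field_simp
    ring
  have hSg0 : ∀ (p : ℂ) (r : ℝ), convexHull ℝ {p, p + r, p + r * triZeta} ⊆ R.carrier →
      triangleIntegral Sg p (p + r) (p + r * triZeta) = 0 := by
    intro p r hsub
    have hc : ∀ i, ContinuousOn (F i) (convexHull ℝ {p, p + r, p + r * triZeta}) := fun i =>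
      (hFc i).continuousOn
    have h36' : ∀ i, triangleIntegral (F i) p (p + r) (p + r * triZeta) = 0 := fun i => by
      rw [hF]; exact h36 i p r hsub
    rw [hSg_eq, triangleIntegral_linear (hc 0) (hc 1) (hc 2), h36' 0, h36' 1, h36' 2]
    ring
  -- lattice Morera and the open mapping theorem
  have hSgd : DifferentiableOn ℂ Sg R.carrier :=
    differentiableOn_of_forall_latticeTriangle triZeta_im_ne_zero R.isOpen hSgc.continuousOn hSg0
  obtain ⟨s₀, hs₀⟩ := exists_eq_const_of_im_eq_zero R.isOpen R.isConnected.isPreconnected hSgd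
    (fun z _ => by rw [hSg]; simp)
  have hSg_cl : EqOn Sg (fun _ => s₀) (closure R.carrier) :=
    EqOn.of_subset_closure (fun z hz => hs₀ z hz) hSgc.continuousOn continuousOn_const
      subset_closure Subset.rfl
  refine ⟨s₀.re, fun z hz => ?_⟩
  have h := congrArg Complex.re (hSg_cl hz)
  rw [hSg] at h
  simpa using h

end Summit.CriticalPhenomena.CardyFormulaZ2.Theorems.BondTriangularCardyLine

end
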